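import Mathlib
import Literature.Probability.PointProcesses.LensConsistentLaw
import Literature.MathematicalPhysics.StatisticalMechanics.TransferLevelValue
import HarnessLib

/-!
# Crux `PatternPricedCertificates` (stmt-AtomisticToContinuum-12974), line `registered` — stub `stub_levelRestrict`

This file discharges the registered stub `stub_levelRestrict` of line `registered` for crux
stmt-AtomisticToContinuum-12974
(`Summit.AtomisticToContinuum.Crystallization.Theses.FrustrationRangeCertificates.PatternPricedCertificates`).

**Statement (restriction of transports between levels).** Rooted patterns `S : Finset E`
(`E = ℝ³`) are relative positions seen from a root at `0`; `B_r = ballPattern r` cuts a pattern to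
the closed `r`-ball, `lens r L S = {v ∈ S | ‖v‖ ≤ L − r}` is the lens range and `reroot S v` the
pattern re-rooted at `v`. The level-`(r, L)` transport of a rule `g` is
`T^{(r,L)}_g S = Σ_{v ∈ lens r L S} [g v (B_r S) (B_r (reroot S v)) − g (−v) (B_r (reroot S v)) (B_r S)]`.
For `0 ≤ r ≤ r'` and `ρ − r ≤ L − r'`, the level-`(r, ρ)` transport of `g` evaluated on the `ρ`-ball
`B_ρ S` equals the level-`(r', L)` transport, evaluated on `S` itself, of the restricted rule
`ĝ v p q := 1[‖v‖ ≤ ρ − r] · g v (B_r p) (B_r q)`.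

**Proof (pure `Finset` algebra).**
* `levelRestrict_ballPattern_ballPattern`: `B_r (B_{r'} S) = B_r S` for `r ≤ r'`;
* `levelRestrict_ballPattern_reroot`: `B_r (reroot (B_ρ S) v) = B_r (reroot S v)` for
  `‖v‖ ≤ ρ − r` (a point `u` of `S` with `‖u − v‖ ≤ r` has `‖u‖ ≤ r + (ρ − r) = ρ`);
* `levelRestrict_lens`: `lens r ρ (B_ρ S) = {v ∈ lens r' L S | ‖v‖ ≤ ρ − r}` for `0 ≤ r` and
  `ρ − r ≤ L − r'`;
so the left sum is the right sum with the indicator `1[‖v‖ ≤ ρ − r]` inserted (`Finset.sum_filter`,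
`‖−v‖ = ‖v‖`), and on the indicator's support the summands agree term by term (`r ≤ ρ` there, as
`0 ≤ ‖v‖ ≤ ρ − r`).

No new definitions; nothing is assumed. [folklore]
-/

noncomputable section

open scoped BigOperators Classical

namespace Summit.AtomisticToContinuum.Crystallization.Theorems.PatternPricedCertificates

open Literature.Probability.PointProcesses (ballPattern lens reroot)

section Helpers

variable {E : Type*} [NormedAddCommGroup E]

/-- Cutting to the `r'`-ball and then to the `r`-ball, `r ≤ r'`, is cutting to the `r`-ball:
`B_r (B_{r'} S) = B_r S`. [folklore] -/
theorem levelRestrict_ballPattern_ballPattern {r r' : ℝ} (h : r ≤ r') (S : Finset E) :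
    ballPattern r (ballPattern r' S) = ballPattern r S := by
  ext w
  simp only [ballPattern, Finset.mem_filter]
  exact ⟨fun hw => ⟨hw.1.1, hw.2⟩, fun hw => ⟨⟨hw.1, hw.2.trans h⟩, hw.2⟩⟩

/-- For `0 ≤ r` and `ρ − r ≤ L − r'`, the level-`(r, ρ)` lens range of the `ρ`-ball of a pattern is
the part of its level-`(r', L)` lens range of norm `≤ ρ − r`. [folklore] -/
theorem levelRestrict_lens {r r' ρ L : ℝ} (hr : 0 ≤ r) (hρL : ρ - r ≤ L - r') (S : Finset E) :
    lens r ρ (ballPattern ρ S) = (lens r' L S).filter fun v => ‖v‖ ≤ ρ - r := by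
  ext v
  simp only [lens, ballPattern, Finset.mem_filter]
  constructor
  · rintro ⟨⟨hvS, -⟩, hv⟩
    exact ⟨⟨hvS, hv.trans hρL⟩, hv⟩
  · rintro ⟨⟨hvS, -⟩, hv⟩
    exact ⟨⟨hvS, by linarith⟩, hv⟩

variable [DecidableEq E]

/-- For a displacement `v` with `‖v‖ ≤ ρ − r`, the `r`-ball of the re-rooted pattern only sees the
`ρ`-ball of the original one: `B_r (reroot (B_ρ S) v) = B_r (reroot S v)` (a point `u` with
`‖u − v‖ ≤ r` has `‖u‖ ≤ ‖u − v‖ + ‖v‖ ≤ r + (ρ − r) = ρ`). [folklore] -/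
theorem levelRestrict_ballPattern_reroot {r ρ : ℝ} (S : Finset E) {v : E} (hv : ‖v‖ ≤ ρ - r) :
    ballPattern r (reroot (ballPattern ρ S) v) = ballPattern r (reroot S v) := by
  ext w
  simp only [ballPattern, reroot, Finset.mem_filter, Finset.mem_erase, Finset.mem_image,
    Finset.mem_insert]
  constructor
  · rintro ⟨⟨hw0, u, hu, rfl⟩, hwr⟩
    exact ⟨⟨hw0, u, hu.imp id And.left, rfl⟩, hwr⟩
  · rintro ⟨⟨hw0, u, hu, rfl⟩, hwr⟩
    refine ⟨⟨hw0, u, hu.imp id fun huS => ⟨huS, ?_⟩, rfl⟩, hwr⟩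
    have h := norm_add_le (u - v) v
    rw [sub_add_cancel] at h
    linarith

end Helpers

/-- **Stub `stub_levelRestrict` (restriction of transports between levels).** For `0 ≤ r ≤ r'` and
`ρ − r ≤ L − r'`, the level-`(r, ρ)` transport of a rule `g` evaluated on the `ρ`-ball of a pattern
is the level-`(r', L)` transport, on the pattern itself, of the rule
`ĝ v p q = 1[‖v‖ ≤ ρ − r] · g v (B_r p) (B_r q)` (`B_r ∘ B_{r'} = B_r`,
`B_r (reroot (B_ρ S) v) = B_r (reroot S v)` for `‖v‖ ≤ ρ − r`, and the lens ranges agree up to the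
indicator). [folklore] -/
theorem stub_levelRestrict :
    ∀ (r r' ρ L : ℝ), 0 ≤ r → r ≤ r' → ρ - r ≤ L - r' →
      ∀ (g : EuclideanSpace ℝ (Fin 3) → Finset (EuclideanSpace ℝ (Fin 3)) → Finset (EuclideanSpace ℝ (Fin 3)) → ℝ) (S : Finset (EuclideanSpace ℝ (Fin 3))),
        (∑ v ∈ Literature.Probability.PointProcesses.lens r ρ (Literature.Probability.PointProcesses.ballPattern ρ S), (g v (Literature.Probability.PointProcesses.ballPattern r (Literature.Probability.PointProcesses.ballPattern ρ S)) (Literature.Probability.PointProcesses.ballPattern r (Literature.Probability.PointProcesses.reroot (Literature.Probability.PointProcesses.ballPattern ρ S) v)) - g (-v) (Literature.Probability.PointProcesses.ballPattern r (Literature.Probability.PointProcesses.reroot (Literature.Probability.PointProcesses.ballPattern ρ S) v)) (Literature.Probability.PointProcesses.ballPattern r (Literature.Probability.PointProcesses.ballPattern ρ S)))) =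
        ∑ v ∈ Literature.Probability.PointProcesses.lens r' L S, ((fun v p q => if ‖v‖ ≤ ρ - r then g v (Literature.Probability.PointProcesses.ballPattern r p) (Literature.Probability.PointProcesses.ballPattern r q) else 0) v (Literature.Probability.PointProcesses.ballPattern r' S) (Literature.Probability.PointProcesses.ballPattern r' (Literature.Probability.PointProcesses.reroot S v)) - (fun v p q => if ‖v‖ ≤ ρ - r then g v (Literature.Probability.PointProcesses.ballPattern r p) (Literature.Probability.PointProcesses.ballPattern r q) else 0) (-v) (Literature.Probability.PointProcesses.ballPattern r' (Literature.Probability.PointProcesses.reroot S v)) (Literature.Probability.PointProcesses.ballPattern r' S)) := by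
  intro r r' ρ L hr hrr' hρL g S
  rw [levelRestrict_lens hr hρL S, Finset.sum_filter]
  refine Finset.sum_congr rfl fun v _ => ?_
  dsimp only
  rw [norm_neg]
  split_ifs with hv
  · have hrρ : r ≤ ρ := by linarith [norm_nonneg v]
    rw [levelRestrict_ballPattern_ballPattern hrρ S, levelRestrict_ballPattern_reroot S hv,
      levelRestrict_ballPattern_ballPattern hrr' S,
      levelRestrict_ballPattern_ballPattern hrr' (reroot S v)]
  · exact (sub_self 0).symm

end Summit.AtomisticToContinuum.Crystallization.Theorems.PatternPricedCertificates

end
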